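import Literature.NumberTheory.Weil1964.ArchFollandTorusKType
import Literature.NumberTheory.Automorphic.AdelicSchwartzBruhatDirectSumPure
import Literature.Analysis.SegalBargmann.SchwartzTensorPi
import Literature.RepresentationTheory.KonnoKonno2007.JunctionSwapBargmann
import HarnessLib

/-!
# Folland–Hermite functions of the juxtaposed scaled frame are products along the split `ι₁ ⊕ ι₂` (S2d, all `K_∞`-types)

Topic `NumberTheory/Weil1964`; namespace `Literature.NumberTheory.Weil1964`.  THEOREMS ONLY.  Cell `hodgecm-mathlib`,
(T2) [Liu2021, Thm 4.15] stub S2 «theta restricts to theta», piece **S2d β** (A-p09 12:43:32Z: the theta ONE-forms carry the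
degree-one `K_∞`-type `h_β`, `|β| = 1`, not the vacuum; block-supported indices suffice).  Sibling of
`ArchFollandGaussianSplit` (`β = 0`) and `Automorphic/AdelicSchwartzBruhatDirectSumSpan` (adelic bookkeeping).

For a totally real `F`, index types `ι₁, ι₂`, scale functions `D₁` on `ι₁ × {real places}`, `D₂` on `ι₂ × {real places}` and the
JUXTAPOSED scaled frame `e_{D₁ ⊔ D₂}` on `(ι₁ ⊕ ι₂) → F ⊗ ℝ` (Folland frames `scaledFrame`, [Folland1989] §1.3/(1.25)), the Hermite
function `h_γ ∘ e_{D₁ ⊔ D₂}` (`follandHermite`, [Folland1989] §1.7 (1.81)) of the JUXTAPOSED multi-index `γ = β₁ ⊔ β₂` — the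
tree's `sumIdx β₁ β₂` on `(ι₁ × P) ⊕ (ι₂ × P)` relabelled to `(ι₁ ⊕ ι₂) × P` along `Equiv.sumProdDistrib` — IS the product in
separate variables `archBoxTensor (h_{β₁} ∘ e_{D₁}) (h_{β₂} ∘ e_{D₂})` (`archBoxTensor_follandHermite_sumIdx_eq`).  Every
multi-index on `(ι₁ ⊕ ι₂) × P` is such a `γ` (`hermitePi_eq_tensorPi`); the BLOCK-SUPPORTED cases `β₂ = 0` / `β₁ = 0` are Liu's
«`φ_{⋆,i} ⊗ φ_{⋆,i}^⊥`» with one factor the vacuum (`archBoxTensor_follandHermite_left_eq`, `…_right_eq`).  With the adelic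
sibling: the adelic test vector `h_γ ⊗ finSumEquiv (f₁ ⊗ f₂)` is the pure tensor `(h_{β₁} ⊗ f₁) ⊠ (h_{β₂} ⊗ f₂)`
(`piSchwartzBruhatEquiv_follandHermite_sumIdx_tmul_eq_tensorToSum`) — «we can find finitely many pairs», l. 2199–2203.
Proof = TRANSPORT of the tree's `hermitePi_sumIdx` (Hermite functions on `ℝ^{σ₁ ⊕ σ₂}` are products, [Folland1989] §1.7) along
`rename_herm` / `hermiteFun_comp_equiv` (relabelling by a bijection) and the pointwise formula of `scaledFrame`.
[cite: Folland1989, §1.7 (1.81) (Hermite functions on `ℝⁿ` are products of one-variable Hermite functions)]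
[cite: Liu2021, proof of Thm. 4.15 (FJcycle.tex l. 2193–2203)]
-/

set_option autoImplicit false

noncomputable section

open NumberField NumberField.InfinitePlace NumberField.mixedEmbedding MvPolynomial
open Literature.Analysis.SegalBargmann Literature.NumberTheory.Automorphic
open scoped SchwartzMap TensorProduct Classical

namespace Literature.NumberTheory.Weil1964

variable {F : Type} [Field F] [NumberField F] [IsTotallyReal F] {ι₁ ι₂ : Type} [Fintype ι₁] [Fintype ι₂]

/-- **Hermite functions of the juxtaposed frame are products**: for multi-indices `β₁` on `ι₁ × P`, `β₂` on `ι₂ × P`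
(`P` = real places of the totally real `F`) and the juxtaposed index `γ = (sumIdx β₁ β₂) ∘ sumProdDistrib` on `(ι₁ ⊕ ι₂) × P`,
`h_γ ∘ e_{D₁ ⊔ D₂} = archBoxTensor (h_{β₁} ∘ e_{D₁}) (h_{β₂} ∘ e_{D₂})`.
[cite: Folland1989, §1.7 (1.81)] [cite: Liu2021, proof of Thm. 4.15 (FJcycle.tex l. 2199–2203)] -/
theorem archBoxTensor_follandHermite_sumIdx_eq (D₁ : ι₁ × {v : InfinitePlace F // v.IsReal} → ℝ) (hD₁ : ∀ k, D₁ k ≠ 0)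
    (D₂ : ι₂ × {v : InfinitePlace F // v.IsReal} → ℝ) (hD₂ : ∀ k, D₂ k ≠ 0)
    (hD : ∀ k : (ι₁ ⊕ ι₂) × {v : InfinitePlace F // v.IsReal}, Sum.elim (fun i => D₁ (i, k.2)) (fun j => D₂ (j, k.2)) k.1 ≠ 0)
    (β₁ : ι₁ × {v : InfinitePlace F // v.IsReal} →₀ ℕ) (β₂ : ι₂ × {v : InfinitePlace F // v.IsReal} →₀ ℕ) :
    archBoxTensor (follandHermite (scaledFrame F ι₁ D₁ hD₁) β₁) (follandHermite (scaledFrame F ι₂ D₂ hD₂) β₂) =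
      follandHermite (scaledFrame F (ι₁ ⊕ ι₂) (fun k => Sum.elim (fun i => D₁ (i, k.2)) (fun j => D₂ (j, k.2)) k.1) hD)
        ((sumIdx β₁ β₂).equivMapDomain (Equiv.sumProdDistrib ι₁ ι₂ {v : InfinitePlace F // v.IsReal}).symm) := by
  -- transport of `hermitePi_sumIdx` along the relabelling `sumProdDistrib`
  have key : ∀ y : (ι₁ ⊕ ι₂) × {v : InfinitePlace F // v.IsReal} → ℝ,
      hermitePi ((sumIdx β₁ β₂).equivMapDomain (Equiv.sumProdDistrib ι₁ ι₂ {v : InfinitePlace F // v.IsReal}).symm) y =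
        hermitePi β₁ ((y ∘ (Equiv.sumProdDistrib ι₁ ι₂ {v : InfinitePlace F // v.IsReal}).symm) ∘ Sum.inl) *
          hermitePi β₂ ((y ∘ (Equiv.sumProdDistrib ι₁ ι₂ {v : InfinitePlace F // v.IsReal}).symm) ∘ Sum.inr) := by
    intro y
    rw [hermitePi_apply, ← rename_herm, ← hermiteFun_comp_equiv, ← hermitePi_apply, hermitePi_sumIdx, tensorPi_apply]
  ext x
  -- after `key` the two sides agree definitionally: `e_{D₁⊔D₂} x ∘ sumProdDistrib⁻¹ ∘ inl = e_{D₁} (x ∘ inl)` pointwise by `rfl`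
  rw [archBoxTensor_apply, follandHermite_apply, follandHermite_apply, follandHermite_apply, key]
  congr 1

/-- **Block-1-supported indices** (Liu's `φ_{⋆,i} ⊗ φ_{⋆,i}^⊥` with the `V⋆^⊥`-factor the vacuum; the degree-one `K_∞`-types
`|β₁| = 1` of the theta one-forms are of this shape): `h_{β₁ ⊔ 0} ∘ e_{D₁ ⊔ D₂} = (h_{β₁} ∘ e_{D₁}) ⊠_∞ (h_0 ∘ e_{D₂})`.
[cite: Folland1989, §1.7 (1.81)] [cite: Liu2021, proof of Thm. 4.15 (FJcycle.tex l. 2199–2203)] -/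
theorem archBoxTensor_follandHermite_left_eq (D₁ : ι₁ × {v : InfinitePlace F // v.IsReal} → ℝ) (hD₁ : ∀ k, D₁ k ≠ 0)
    (D₂ : ι₂ × {v : InfinitePlace F // v.IsReal} → ℝ) (hD₂ : ∀ k, D₂ k ≠ 0)
    (hD : ∀ k : (ι₁ ⊕ ι₂) × {v : InfinitePlace F // v.IsReal}, Sum.elim (fun i => D₁ (i, k.2)) (fun j => D₂ (j, k.2)) k.1 ≠ 0)
    (β₁ : ι₁ × {v : InfinitePlace F // v.IsReal} →₀ ℕ) :
    archBoxTensor (follandHermite (scaledFrame F ι₁ D₁ hD₁) β₁) (follandHermite (scaledFrame F ι₂ D₂ hD₂) 0) =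
      follandHermite (scaledFrame F (ι₁ ⊕ ι₂) (fun k => Sum.elim (fun i => D₁ (i, k.2)) (fun j => D₂ (j, k.2)) k.1) hD)
        ((sumIdx β₁ (0 : ι₂ × {v : InfinitePlace F // v.IsReal} →₀ ℕ)).equivMapDomain
          (Equiv.sumProdDistrib ι₁ ι₂ {v : InfinitePlace F // v.IsReal}).symm) :=
  archBoxTensor_follandHermite_sumIdx_eq D₁ hD₁ D₂ hD₂ hD β₁ 0

/-- **Block-2-supported indices**: `h_{0 ⊔ β₂} ∘ e_{D₁ ⊔ D₂} = (h_0 ∘ e_{D₁}) ⊠_∞ (h_{β₂} ∘ e_{D₂})`.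
[cite: Folland1989, §1.7 (1.81)] [cite: Liu2021, proof of Thm. 4.15 (FJcycle.tex l. 2199–2203)] -/
theorem archBoxTensor_follandHermite_right_eq (D₁ : ι₁ × {v : InfinitePlace F // v.IsReal} → ℝ) (hD₁ : ∀ k, D₁ k ≠ 0)
    (D₂ : ι₂ × {v : InfinitePlace F // v.IsReal} → ℝ) (hD₂ : ∀ k, D₂ k ≠ 0)
    (hD : ∀ k : (ι₁ ⊕ ι₂) × {v : InfinitePlace F // v.IsReal}, Sum.elim (fun i => D₁ (i, k.2)) (fun j => D₂ (j, k.2)) k.1 ≠ 0)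
    (β₂ : ι₂ × {v : InfinitePlace F // v.IsReal} →₀ ℕ) :
    archBoxTensor (follandHermite (scaledFrame F ι₁ D₁ hD₁) 0) (follandHermite (scaledFrame F ι₂ D₂ hD₂) β₂) =
      follandHermite (scaledFrame F (ι₁ ⊕ ι₂) (fun k => Sum.elim (fun i => D₁ (i, k.2)) (fun j => D₂ (j, k.2)) k.1) hD)
        ((sumIdx (0 : ι₁ × {v : InfinitePlace F // v.IsReal} →₀ ℕ) β₂).equivMapDomain
          (Equiv.sumProdDistrib ι₁ ι₂ {v : InfinitePlace F // v.IsReal}).symm) :=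
  archBoxTensor_follandHermite_sumIdx_eq D₁ hD₁ D₂ hD₂ hD 0 β₂

/-- **Every Hermite function of the juxtaposed frame is a product** (every multi-index on `(ι₁ ⊕ ι₂) × P` is a juxtaposed index:
its two restrictions along `sumProdDistrib`). [cite: Folland1989, §1.7 (1.81)] -/
theorem follandHermite_juxtaposed_eq_archBoxTensor (D₁ : ι₁ × {v : InfinitePlace F // v.IsReal} → ℝ) (hD₁ : ∀ k, D₁ k ≠ 0)
    (D₂ : ι₂ × {v : InfinitePlace F // v.IsReal} → ℝ) (hD₂ : ∀ k, D₂ k ≠ 0)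
    (hD : ∀ k : (ι₁ ⊕ ι₂) × {v : InfinitePlace F // v.IsReal}, Sum.elim (fun i => D₁ (i, k.2)) (fun j => D₂ (j, k.2)) k.1 ≠ 0)
    (γ : (ι₁ ⊕ ι₂) × {v : InfinitePlace F // v.IsReal} →₀ ℕ) :
    follandHermite (scaledFrame F (ι₁ ⊕ ι₂) (fun k => Sum.elim (fun i => D₁ (i, k.2)) (fun j => D₂ (j, k.2)) k.1) hD) γ =
      archBoxTensor
        (follandHermite (scaledFrame F ι₁ D₁ hD₁)
          ((γ.equivMapDomain (Equiv.sumProdDistrib ι₁ ι₂ {v : InfinitePlace F // v.IsReal})).comapDomain Sum.inl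
            Sum.inl_injective.injOn))
        (follandHermite (scaledFrame F ι₂ D₂ hD₂)
          ((γ.equivMapDomain (Equiv.sumProdDistrib ι₁ ι₂ {v : InfinitePlace F // v.IsReal})).comapDomain Sum.inr
            Sum.inr_injective.injOn)) := by
  rw [archBoxTensor_follandHermite_sumIdx_eq D₁ hD₁ D₂ hD₂ hD, sumIdx_comapDomain]
  congr 1
  ext k
  simp only [Finsupp.equivMapDomain_apply, Equiv.symm_symm, Equiv.symm_apply_apply]

/-- **Adelic corollary («finitely many pairs», Liu l. 2199–2203): the adelic test vector whose archimedean component is a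
Hermite function of the juxtaposed frame and whose finite component is a pure tensor IS a pure tensor `Φ⋆ ⊠ Φ^⊥`** — hence
(by linearity in the finite component, `AdelicSchwartzBruhatDirectSumSpan`) every such vector with ANY finite component is a
finite sum of pure tensors. [cite: Liu2021, proof of Thm. 4.15 (FJcycle.tex l. 2199–2203)] [cite: Folland1989, §1.7 (1.81)] -/
theorem piSchwartzBruhatEquiv_follandHermite_sumIdx_tmul_eq_tensorToSum
    (D₁ : ι₁ × {v : InfinitePlace F // v.IsReal} → ℝ) (hD₁ : ∀ k, D₁ k ≠ 0)
    (D₂ : ι₂ × {v : InfinitePlace F // v.IsReal} → ℝ) (hD₂ : ∀ k, D₂ k ≠ 0)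
    (hD : ∀ k : (ι₁ ⊕ ι₂) × {v : InfinitePlace F // v.IsReal}, Sum.elim (fun i => D₁ (i, k.2)) (fun j => D₂ (j, k.2)) k.1 ≠ 0)
    (β₁ : ι₁ × {v : InfinitePlace F // v.IsReal} →₀ ℕ) (β₂ : ι₂ × {v : InfinitePlace F // v.IsReal} →₀ ℕ)
    (f₁ : FinSB F ι₁) (f₂ : FinSB F ι₂) :
    piSchwartzBruhatEquiv F (ι₁ ⊕ ι₂)
        (follandHermite (scaledFrame F (ι₁ ⊕ ι₂) (fun k => Sum.elim (fun i => D₁ (i, k.2)) (fun j => D₂ (j, k.2)) k.1) hD)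
          ((sumIdx β₁ β₂).equivMapDomain (Equiv.sumProdDistrib ι₁ ι₂ {v : InfinitePlace F // v.IsReal}).symm) ⊗ₜ
          finSumEquiv F ι₁ ι₂ (f₁ ⊗ₜ f₂)) =
      tensorToSum F ι₁ ι₂ (piSchwartzBruhatEquiv F ι₁ (follandHermite (scaledFrame F ι₁ D₁ hD₁) β₁ ⊗ₜ f₁))
        (piSchwartzBruhatEquiv F ι₂ (follandHermite (scaledFrame F ι₂ D₂ hD₂) β₂ ⊗ₜ f₂)) := by
  rw [← archBoxTensor_follandHermite_sumIdx_eq D₁ hD₁ D₂ hD₂ hD]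
  exact (tensorToSum_tmul _ _ _ _).symm

end Literature.NumberTheory.Weil1964

end
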